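import Mathlib
import Literature.Analysis.UnboundedOperators.ConjugateOperatorRegularity
import HarnessLib
import Summits.AtomisticToContinuum.FouriersLaw.Theorems.EmbeddedDrudeMourreMourreDissolutionLAPResolventIdentity

/-!
# Stub `stub_mourreThresholdLAP` — F1a: Mourre's dissipative resolvent family, invertibility

Item `stmt-AtomisticToContinuum-12594` (crux `MourreDissolution` of route `EmbeddedDrudeMourre`,
sub-problem `FouriersLaw`), line `separable-vertex-faddeev-pair-sector`, stub S6
`stub_mourreThresholdLAP` (Mourre's limiting absorption principle, `C²` form), helper F1 of the
proof map (Mourre 1981; ABG = Amrein–Boutet de Monvel–Georgescu 1996, Lemmas 7.3.3–7.3.4, here for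
unbounded `H` through its bounded resolvent), part 1/3.

Setting: `U(t) = e^{itH}` a one-parameter unitary group, `R(z) = resolventAt U z = (H - z)⁻¹`
(`…LAPResolventCalculus`, `…LAPResolventIdentity`), `M` a bounded operator with
`0 ≤ Re ⟪f, M f⟫` (dissipativity; for the Mourre commutator `M = φ(H)[H, iA]φ(H) ≥ 0`), a real
parameter `ε` and a non-real `z` with `ε · Im z ≤ 0` (the LAP has `Im z < 0`, `ε ≥ 0`, where
`ε * z.im ≤ 0` is `mul_nonpos_of_nonneg_of_nonpos`; the mirrored half `Im z > 0`, `ε ≤ 0` is what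
adjoints produce, so both are treated at once).

* §1 the bounded operators `K = mourreK U M ε z = 1 + iε M R(z)` and
  `K̃ = mourreKt U M ε z = 1 + iε R(z) M`, their `Ring.inverse`s `mourreKinv`, `mourreKtinv`,
  MOURRE'S DISSIPATIVE RESOLVENT `G = mourreG U M ε z = R(z) Kinv` ("`(H - z + iεM)⁻¹`"), and
  DISSIPATIVITY: `|Im z| ‖R(z) f‖ ≤ ‖K f‖`, `‖f‖ ≤ (1 + |ε| ‖M‖ / |Im z|) ‖K f‖ (from
  `Im ⟪f, R(z) f⟫ = Im z ‖R(z) f‖²` and `Re ⟪g, M g⟫ ≥ 0`);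
* §2 the adjoints `K† = K̃_{-ε}(z̄)[M†]`, `K̃† = K_{-ε}(z̄)[M†]`, and INVERTIBILITY of `K` in `B(H)`
  (bounded below + dense range, the kernel of `K†` being trivial by the same dissipativity):
  `K Kinv = Kinv K = 1`, `‖Kinv‖ ≤ 1 + |ε| ‖M‖ / |Im z|`;
* §3 `‖G‖ ≤ 1/|Im z|`; §4 the headline `mourreK_isUnit_dissipative`.

The algebra of `G` (`Kinv = 1 - iε M G`, push-through `G = K̃⁻¹ R(z)`, `(H - z + iεM) G = 1`, the
resolvent identities in `z` and `ε`) is in `…LAPDissipativeResolventIdentities`; the `ε`-derivative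
`G' = -i G M G` and the adjoint `G[M]† = G_{-ε}(z̄)[M†]` are in `…LAPDissipativeResolventDeriv`.
-/

noncomputable section

open MeasureTheory Complex Filter Topology Set
open scoped InnerProductSpace ComplexConjugate ENNReal NNReal

namespace Summit.AtomisticToContinuum.FouriersLaw.Theorems.MourreDissolution

open Literature.Analysis.UnboundedOperators
open Literature.Analysis.UnboundedOperators.UnitaryRep

variable {H : Type*} [NormedAddCommGroup H] [InnerProductSpace ℂ H] [CompleteSpace H]

/-! ## §1. The operators `K = 1 + iε M R(z)`, `K̃ = 1 + iε R(z) M`; dissipativity -/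

/-- Mourre's bounded operator `K_ε(z) = 1 + iε M R(z)`, the bounded form of `H - z + iεM`
(`H - z + iεM = K_ε(z) (H - z)` on `D(H)`).
[cite: AmreinBoutetdeMonvelGeorgescu1996, Lemma 7.3.3] -/
def mourreK (U : OneParameterUnitaryGroup H) (M : H →L[ℂ] H) (ε : ℝ) (z : ℂ) : H →L[ℂ] H :=
  1 + ((I : ℂ) * ε) • (M * resolventAt U z)

/-- The transposed form `K̃_ε(z) = 1 + iε R(z) M` (`H - z + iεM = (H - z) K̃_ε(z)` on `D(H)`).
[cite: AmreinBoutetdeMonvelGeorgescu1996, Lemma 7.3.3] -/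
def mourreKt (U : OneParameterUnitaryGroup H) (M : H →L[ℂ] H) (ε : ℝ) (z : ℂ) : H →L[ℂ] H :=
  1 + ((I : ℂ) * ε) • (resolventAt U z * M)

/-- The bounded inverse `K_ε(z)⁻¹` (as `Ring.inverse`; it is a genuine two-sided inverse whenever
`K_ε(z)` is a unit, in particular for dissipative `M` and `ε · Im z ≤ 0`, and `0` otherwise).
[cite: AmreinBoutetdeMonvelGeorgescu1996, Lemma 7.3.3] -/
def mourreKinv (U : OneParameterUnitaryGroup H) (M : H →L[ℂ] H) (ε : ℝ) (z : ℂ) : H →L[ℂ] H :=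
  Ring.inverse (mourreK U M ε z)

/-- The bounded inverse `K̃_ε(z)⁻¹` (as `Ring.inverse`).
[cite: AmreinBoutetdeMonvelGeorgescu1996, Lemma 7.3.3] -/
def mourreKtinv (U : OneParameterUnitaryGroup H) (M : H →L[ℂ] H) (ε : ℝ) (z : ℂ) : H →L[ℂ] H :=
  Ring.inverse (mourreKt U M ε z)

/-- **Mourre's dissipative resolvent** `G_ε(z) = R(z) K_ε(z)⁻¹`, the bounded operator playing the
role of `(H - z + iεM)⁻¹`. [cite: AmreinBoutetdeMonvelGeorgescu1996, Lemma 7.3.3] -/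
def mourreG (U : OneParameterUnitaryGroup H) (M : H →L[ℂ] H) (ε : ℝ) (z : ℂ) : H →L[ℂ] H :=
  resolventAt U z * mourreKinv U M ε z

/-- `K f = f + iε M (R(z) f)`. [folklore] -/
theorem mourreK_apply (U : OneParameterUnitaryGroup H) (M : H →L[ℂ] H) (ε : ℝ) (z : ℂ) (f : H) :
    mourreK U M ε z f = f + ((I : ℂ) * ε) • M (resolventAt U z f) := by
  simp [mourreK]

/-- `K̃ f = f + iε R(z) (M f)`. [folklore] -/
theorem mourreKt_apply (U : OneParameterUnitaryGroup H) (M : H →L[ℂ] H) (ε : ℝ) (z : ℂ) (f : H) :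
    mourreKt U M ε z f = f + ((I : ℂ) * ε) • resolventAt U z (M f) := by
  simp [mourreKt]

/-- `G h = R(z) (Kinv h)`. [folklore] -/
theorem mourreG_apply (U : OneParameterUnitaryGroup H) (M : H →L[ℂ] H) (ε : ℝ) (z : ℂ) (h : H) :
    mourreG U M ε z h = resolventAt U z (mourreKinv U M ε z h) := rfl

/-- At `ε = 0`: `K_0(z) = 1`. [folklore] -/
theorem mourreK_zero (U : OneParameterUnitaryGroup H) (M : H →L[ℂ] H) (z : ℂ) :
    mourreK U M 0 z = 1 := by
  simp [mourreK]

/-- At `ε = 0`: `K̃_0(z) = 1`. [folklore] -/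
theorem mourreKt_zero (U : OneParameterUnitaryGroup H) (M : H →L[ℂ] H) (z : ℂ) :
    mourreKt U M 0 z = 1 := by
  simp [mourreKt]

/-- At `ε = 0`: `K_0(z)⁻¹ = 1`. [folklore] -/
theorem mourreKinv_zero (U : OneParameterUnitaryGroup H) (M : H →L[ℂ] H) (z : ℂ) :
    mourreKinv U M 0 z = 1 := by
  rw [mourreKinv, mourreK_zero, Ring.inverse_one]

/-- **At `ε = 0` the dissipative resolvent is the resolvent**: `G_0(z) = R(z)`. [folklore] -/
theorem mourreG_zero (U : OneParameterUnitaryGroup H) (M : H →L[ℂ] H) (z : ℂ) :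
    mourreG U M 0 z = resolventAt U z := by
  rw [mourreG, mourreKinv_zero, mul_one]

/-- `K̃ R(z) = R(z) K` (both are `R(z) + iε R(z) M R(z)`). [folklore] -/
theorem mourreKt_mul_resolventAt (U : OneParameterUnitaryGroup H) (M : H →L[ℂ] H) (ε : ℝ)
    (z : ℂ) : mourreKt U M ε z * resolventAt U z = resolventAt U z * mourreK U M ε z := by
  simp only [mourreKt, mourreK, add_mul, mul_add, one_mul, mul_one, smul_mul_assoc, mul_smul_comm,
    mul_assoc]

/-- The sign hypothesis is symmetric under `(ε, z) ↦ (-ε, z̄)`. [folklore] -/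
theorem neg_mul_conj_im (ε : ℝ) (z : ℂ) : -ε * (conj z).im = ε * z.im := by
  rw [Complex.conj_im, neg_mul_neg]

/-- `Im ⟪f, R(z) f⟫ = Im z · ‖R(z) f‖²` (dissipativity of `H - z` in bounded form). [folklore] -/
theorem im_inner_resolventAt_self {z : ℂ} (hz : z.im ≠ 0) (U : OneParameterUnitaryGroup H)
    (f : H) : (⟪f, resolventAt U z f⟫_ℂ).im = z.im * ‖resolventAt U z f‖ ^ 2 := by
  rw [norm_sq_resolventAt_apply hz U f]
  field_simp

/-- `Im ⟪K f, R(z) f⟫ = Im z ‖R(z) f‖² - ε Re ⟪M R(z) f, R(z) f⟫`. [folklore] -/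
theorem im_inner_mourreK_resolventAt {z : ℂ} (hz : z.im ≠ 0) (U : OneParameterUnitaryGroup H)
    (M : H →L[ℂ] H) (ε : ℝ) (f : H) :
    (⟪mourreK U M ε z f, resolventAt U z f⟫_ℂ).im =
      z.im * ‖resolventAt U z f‖ ^ 2 -
        ε * (⟪M (resolventAt U z f), resolventAt U z f⟫_ℂ).re := by
  rw [mourreK_apply, inner_add_left, inner_smul_left, Complex.add_im,
    im_inner_resolventAt_self hz U f]
  simp only [map_mul, Complex.conj_I, Complex.conj_ofReal, Complex.mul_im, Complex.neg_re,
    Complex.I_re, neg_zero, Complex.ofReal_im, mul_zero, Complex.neg_im, Complex.I_im,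
    Complex.ofReal_re, zero_mul, Complex.mul_re, sub_zero, zero_add]
  ring


/-- **Dissipativity, quadratic form**: `|Im z| ‖R(z) f‖² ≤ ‖K f‖ ‖R(z) f‖` when `ε · Im z ≤ 0` and
`Re ⟪g, M g⟫ ≥ 0` (`Im ⟪K f, R f⟫ = Im z ‖R f‖² - ε Re⟪M R f, R f⟫`, both terms of the same sign).
[cite: AmreinBoutetdeMonvelGeorgescu1996, Lemma 7.3.3] -/
theorem abs_im_mul_norm_sq_resolventAt_le {M : H →L[ℂ] H} (hM : ∀ f : H, 0 ≤ (⟪f, M f⟫_ℂ).re)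
    {z : ℂ} (hz : z.im ≠ 0) {ε : ℝ} (hεz : ε * z.im ≤ 0) (U : OneParameterUnitaryGroup H) (f : H) :
    |z.im| * ‖resolventAt U z f‖ ^ 2 ≤ ‖mourreK U M ε z f‖ * ‖resolventAt U z f‖ := by
  set g := resolventAt U z f with hg
  have hre : 0 ≤ (⟪M g, g⟫_ℂ).re := by
    rw [← RCLike.re_to_complex, inner_re_symm, RCLike.re_to_complex]
    exact hM g
  have hab : 0 ≤ (z.im * ‖g‖ ^ 2) * (-(ε * (⟪M g, g⟫_ℂ).re)) := by
    have h1 : 0 ≤ -(ε * z.im) := by linarith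
    calc (0 : ℝ) ≤ -(ε * z.im) * (‖g‖ ^ 2 * (⟪M g, g⟫_ℂ).re) :=
          mul_nonneg h1 (mul_nonneg (sq_nonneg _) hre)
      _ = _ := by ring
  have key : |z.im * ‖g‖ ^ 2| ≤ |(⟪mourreK U M ε z f, g⟫_ℂ).im| := by
    rw [hg, im_inner_mourreK_resolventAt hz U M ε f, ← hg, sub_eq_add_neg]
    exact sq_le_sq.1 (by nlinarith [hab])
  rw [abs_mul, abs_of_nonneg (sq_nonneg ‖g‖)] at key
  exact key.trans ((Complex.abs_im_le_norm _).trans (norm_inner_le_norm _ _))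

/-- **Dissipativity, linear form**: `|Im z| ‖R(z) f‖ ≤ ‖K f‖`.
[cite: AmreinBoutetdeMonvelGeorgescu1996, Lemma 7.3.3] -/
theorem abs_im_mul_norm_resolventAt_le {M : H →L[ℂ] H} (hM : ∀ f : H, 0 ≤ (⟪f, M f⟫_ℂ).re)
    {z : ℂ} (hz : z.im ≠ 0) {ε : ℝ} (hεz : ε * z.im ≤ 0) (U : OneParameterUnitaryGroup H) (f : H) :
    |z.im| * ‖resolventAt U z f‖ ≤ ‖mourreK U M ε z f‖ := by
  have h := abs_im_mul_norm_sq_resolventAt_le hM hz hεz U f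
  rcases (norm_nonneg (resolventAt U z f)).eq_or_lt with h0 | hpos
  · rw [← h0, mul_zero]; exact norm_nonneg _
  · refine le_of_mul_le_mul_right ?_ hpos
    calc |z.im| * ‖resolventAt U z f‖ * ‖resolventAt U z f‖
        = |z.im| * ‖resolventAt U z f‖ ^ 2 := by ring
      _ ≤ ‖mourreK U M ε z f‖ * ‖resolventAt U z f‖ := h

/-- **`K` is bounded below**: `‖f‖ ≤ (1 + |ε| ‖M‖ |Im z|⁻¹) ‖K f‖` (`f = K f - iε M R(z) f` and the
linear dissipativity bound). [cite: AmreinBoutetdeMonvelGeorgescu1996, Lemma 7.3.3] -/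
theorem norm_le_norm_mourreK {M : H →L[ℂ] H} (hM : ∀ f : H, 0 ≤ (⟪f, M f⟫_ℂ).re)
    {z : ℂ} (hz : z.im ≠ 0) {ε : ℝ} (hεz : ε * z.im ≤ 0) (U : OneParameterUnitaryGroup H) (f : H) :
    ‖f‖ ≤ (1 + |ε| * ‖M‖ * |z.im|⁻¹) * ‖mourreK U M ε z f‖ := by
  have hB := abs_im_mul_norm_resolventAt_le hM hz hεz U f
  have hpos : 0 < |z.im| := abs_pos.2 hz
  have h1 : ‖resolventAt U z f‖ ≤ |z.im|⁻¹ * ‖mourreK U M ε z f‖ := by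
    rw [← div_eq_inv_mul, le_div_iff₀' hpos]; exact hB
  have h2 : ‖f‖ ≤ ‖mourreK U M ε z f‖ + |ε| * ‖M‖ * ‖resolventAt U z f‖ := by
    have e : f = mourreK U M ε z f - ((I : ℂ) * ε) • M (resolventAt U z f) := by
      rw [mourreK_apply, add_sub_cancel_right]
    calc ‖f‖ = ‖mourreK U M ε z f - ((I : ℂ) * ε) • M (resolventAt U z f)‖ := congrArg _ e
      _ ≤ ‖mourreK U M ε z f‖ + ‖((I : ℂ) * ε) • M (resolventAt U z f)‖ := norm_sub_le _ _
      _ ≤ ‖mourreK U M ε z f‖ + |ε| * ‖M‖ * ‖resolventAt U z f‖ := by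
          rw [norm_smul, norm_mul, Complex.norm_I, one_mul, Complex.norm_real, Real.norm_eq_abs,
            mul_assoc]
          gcongr
          exact M.le_opNorm _
  calc ‖f‖ ≤ ‖mourreK U M ε z f‖ + |ε| * ‖M‖ * ‖resolventAt U z f‖ := h2
    _ ≤ ‖mourreK U M ε z f‖ + |ε| * ‖M‖ * (|z.im|⁻¹ * ‖mourreK U M ε z f‖) := by gcongr
    _ = (1 + |ε| * ‖M‖ * |z.im|⁻¹) * ‖mourreK U M ε z f‖ := by ring

/-- `K` is antilipschitz with constant `1 + |ε| ‖M‖ / |Im z|`.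
[cite: AmreinBoutetdeMonvelGeorgescu1996, Lemma 7.3.3] -/
theorem antilipschitz_mourreK {M : H →L[ℂ] H} (hM : ∀ f : H, 0 ≤ (⟪f, M f⟫_ℂ).re)
    {z : ℂ} (hz : z.im ≠ 0) {ε : ℝ} (hεz : ε * z.im ≤ 0) (U : OneParameterUnitaryGroup H) :
    AntilipschitzWith ⟨1 + |ε| * ‖M‖ * |z.im|⁻¹, by positivity⟩ (mourreK U M ε z) :=
  ContinuousLinearMap.antilipschitz_of_bound _ fun f => norm_le_norm_mourreK hM hz hεz U f

/-! ## §2. Adjoints; `K` is invertible -/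

/-- `conj (iε) = i(-ε)` for real `ε`. [folklore] -/
theorem star_I_mul_ofReal (ε : ℝ) : star ((I : ℂ) * ε) = (I : ℂ) * ((-ε : ℝ) : ℂ) := by
  rw [Complex.star_def, map_mul, Complex.conj_I, Complex.conj_ofReal, Complex.ofReal_neg, mul_neg,
    neg_mul]

/-- `K_ε(z)† = K̃_{-ε}(z̄)` built on `M†`: `(1 + iε M R(z))† = 1 - iε R(z̄) M†`. [folklore] -/
theorem adjoint_mourreK (U : OneParameterUnitaryGroup H) (M : H →L[ℂ] H) (ε : ℝ) {z : ℂ}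
    (hz : z.im ≠ 0) :
    ContinuousLinearMap.adjoint (mourreK U M ε z) =
      mourreKt U (ContinuousLinearMap.adjoint M) (-ε) (conj z) := by
  rw [mourreK, mourreKt, ← ContinuousLinearMap.star_eq_adjoint, star_add, star_one, star_smul,
    star_mul M (resolventAt U z), star_I_mul_ofReal ε, ContinuousLinearMap.star_eq_adjoint,
    ContinuousLinearMap.star_eq_adjoint, adjoint_resolventAt hz U]

/-- `K̃_ε(z)† = K_{-ε}(z̄)` built on `M†`: `(1 + iε R(z) M)† = 1 - iε M† R(z̄)`. [folklore] -/
theorem adjoint_mourreKt (U : OneParameterUnitaryGroup H) (M : H →L[ℂ] H) (ε : ℝ) {z : ℂ}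
    (hz : z.im ≠ 0) :
    ContinuousLinearMap.adjoint (mourreKt U M ε z) =
      mourreK U (ContinuousLinearMap.adjoint M) (-ε) (conj z) := by
  rw [mourreK, mourreKt, ← ContinuousLinearMap.star_eq_adjoint, star_add, star_one, star_smul,
    star_mul (resolventAt U z) M, star_I_mul_ofReal ε, ContinuousLinearMap.star_eq_adjoint,
    ContinuousLinearMap.star_eq_adjoint, adjoint_resolventAt hz U]

/-- Dissipativity passes to the adjoint: `Re ⟪f, M† f⟫ = Re ⟪f, M f⟫ ≥ 0`. [folklore] -/
theorem re_inner_adjoint_nonneg {M : H →L[ℂ] H} (hM : ∀ f : H, 0 ≤ (⟪f, M f⟫_ℂ).re) (f : H) :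
    0 ≤ (⟪f, ContinuousLinearMap.adjoint M f⟫_ℂ).re := by
  rw [ContinuousLinearMap.adjoint_inner_right, ← RCLike.re_to_complex, inner_re_symm,
    RCLike.re_to_complex]
  exact hM f

/-- **`K̃` is injective** for dissipative `M` and `ε · Im z ≤ 0`: if `h + iε R(z) M h = 0` then,
with `u = M h`, `Re ⟪h, M h⟫ = ε Im z ‖R(z) u‖² ≤ 0`, so it vanishes, and `‖h‖ = |ε| ‖R(z) u‖ = 0`.
[cite: AmreinBoutetdeMonvelGeorgescu1996, Lemma 7.3.3] -/
theorem mourreKt_injective {M : H →L[ℂ] H} (hM : ∀ f : H, 0 ≤ (⟪f, M f⟫_ℂ).re)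
    {z : ℂ} (hz : z.im ≠ 0) {ε : ℝ} (hεz : ε * z.im ≤ 0) (U : OneParameterUnitaryGroup H) {h : H}
    (hh : mourreKt U M ε z h = 0) : h = 0 := by
  set u := M h with hu
  have e : h = -(((I : ℂ) * ε) • resolventAt U z u) := by
    rw [mourreKt_apply] at hh
    exact eq_neg_of_add_eq_zero_left hh
  -- `Re ⟪h, u⟫ = ε Im z ‖R u‖²`
  have hconj : (starRingEnd ℂ) ((I : ℂ) * ε) = -((I : ℂ) * ε) := by
    rw [map_mul, Complex.conj_I, Complex.conj_ofReal, neg_mul]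
  have hre : (⟪h, u⟫_ℂ).re = ε * z.im * ‖resolventAt U z u‖ ^ 2 := by
    rw [e, inner_neg_left, inner_smul_left, hconj, ← inner_conj_symm (resolventAt U z u) u, neg_mul,
      neg_neg, Complex.mul_re, Complex.conj_re, Complex.conj_im, im_inner_resolventAt_self hz U u]
    simp only [Complex.mul_re, Complex.mul_im, Complex.I_re, Complex.I_im, Complex.ofReal_re,
      Complex.ofReal_im, zero_mul, mul_zero, sub_zero, one_mul, zero_add]
    ring
  have h0 : ε * z.im * ‖resolventAt U z u‖ ^ 2 = 0 := by
    refine le_antisymm (mul_nonpos_of_nonpos_of_nonneg hεz (sq_nonneg _)) ?_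
    rw [← hre]; exact hM h
  have h1 : |ε| * ‖resolventAt U z u‖ = 0 := by
    rcases mul_eq_zero.1 h0 with h2 | h2
    · rcases mul_eq_zero.1 h2 with h3 | h3
      · rw [h3, abs_zero, zero_mul]
      · exact absurd h3 hz
    · rw [pow_eq_zero_iff two_ne_zero] at h2; rw [h2, mul_zero]
  rw [← norm_eq_zero, e, norm_neg, norm_smul, norm_mul, Complex.norm_I, one_mul, Complex.norm_real,
    Real.norm_eq_abs, h1]

/-- **`K_ε(z)` is invertible in `B(H)`** for dissipative `M` and `ε · Im z ≤ 0`: bounded below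
(`antilipschitz_mourreK`) with dense range (`(range K)ᗮ = ker K†`, `K† = K̃_{-ε}(z̄)[M†]` is injective
by `mourreKt_injective`). [cite: AmreinBoutetdeMonvelGeorgescu1996, Lemma 7.3.3] -/
theorem isUnit_mourreK {M : H →L[ℂ] H} (hM : ∀ f : H, 0 ≤ (⟪f, M f⟫_ℂ).re)
    {z : ℂ} (hz : z.im ≠ 0) {ε : ℝ} (hεz : ε * z.im ≤ 0) (U : OneParameterUnitaryGroup H) :
    IsUnit (mourreK U M ε z) := by
  rw [ContinuousLinearMap.isUnit_iff_bijective,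
    ContinuousLinearMap.bijective_iff_dense_range_and_antilipschitz]
  refine ⟨?_, _, antilipschitz_mourreK hM hz hεz U⟩
  rw [Submodule.topologicalClosure_eq_top_iff, ContinuousLinearMap.orthogonal_range,
    Submodule.eq_bot_iff]
  intro h hh
  rw [LinearMap.mem_ker, ContinuousLinearMap.coe_coe, adjoint_mourreK U M ε hz] at hh
  have hz' : (conj z).im ≠ 0 := by rw [Complex.conj_im]; exact neg_ne_zero.2 hz
  have hεz' : -ε * (conj z).im ≤ 0 := by rw [neg_mul_conj_im]; exact hεz
  exact mourreKt_injective (re_inner_adjoint_nonneg hM) hz' hεz' U hh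

/-- `K Kinv = 1`. [cite: AmreinBoutetdeMonvelGeorgescu1996, Lemma 7.3.3] -/
theorem mourreK_mul_mourreKinv {M : H →L[ℂ] H} (hM : ∀ f : H, 0 ≤ (⟪f, M f⟫_ℂ).re)
    {z : ℂ} (hz : z.im ≠ 0) {ε : ℝ} (hεz : ε * z.im ≤ 0) (U : OneParameterUnitaryGroup H) :
    mourreK U M ε z * mourreKinv U M ε z = 1 :=
  Ring.mul_inverse_cancel _ (isUnit_mourreK hM hz hεz U)

/-- `Kinv K = 1`. [cite: AmreinBoutetdeMonvelGeorgescu1996, Lemma 7.3.3] -/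
theorem mourreKinv_mul_mourreK {M : H →L[ℂ] H} (hM : ∀ f : H, 0 ≤ (⟪f, M f⟫_ℂ).re)
    {z : ℂ} (hz : z.im ≠ 0) {ε : ℝ} (hεz : ε * z.im ≤ 0) (U : OneParameterUnitaryGroup H) :
    mourreKinv U M ε z * mourreK U M ε z = 1 :=
  Ring.inverse_mul_cancel _ (isUnit_mourreK hM hz hεz U)

/-- `K (Kinv h) = h`. [folklore] -/
theorem mourreK_mourreKinv_apply {M : H →L[ℂ] H} (hM : ∀ f : H, 0 ≤ (⟪f, M f⟫_ℂ).re)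
    {z : ℂ} (hz : z.im ≠ 0) {ε : ℝ} (hεz : ε * z.im ≤ 0) (U : OneParameterUnitaryGroup H) (h : H) :
    mourreK U M ε z (mourreKinv U M ε z h) = h := by
  rw [← mul_apply_eq_comp, mourreK_mul_mourreKinv hM hz hεz U, one_apply_eq_self]

/-- `Kinv (K f) = f`. [folklore] -/
theorem mourreKinv_mourreK_apply {M : H →L[ℂ] H} (hM : ∀ f : H, 0 ≤ (⟪f, M f⟫_ℂ).re)
    {z : ℂ} (hz : z.im ≠ 0) {ε : ℝ} (hεz : ε * z.im ≤ 0) (U : OneParameterUnitaryGroup H) (f : H) :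
    mourreKinv U M ε z (mourreK U M ε z f) = f := by
  rw [← mul_apply_eq_comp, mourreKinv_mul_mourreK hM hz hεz U, one_apply_eq_self]

/-- `‖Kinv‖ ≤ 1 + |ε| ‖M‖ / |Im z|`. [cite: AmreinBoutetdeMonvelGeorgescu1996, Lemma 7.3.3] -/
theorem norm_mourreKinv_le {M : H →L[ℂ] H} (hM : ∀ f : H, 0 ≤ (⟪f, M f⟫_ℂ).re)
    {z : ℂ} (hz : z.im ≠ 0) {ε : ℝ} (hεz : ε * z.im ≤ 0) (U : OneParameterUnitaryGroup H) :
    ‖mourreKinv U M ε z‖ ≤ 1 + |ε| * ‖M‖ * |z.im|⁻¹ :=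
  ContinuousLinearMap.opNorm_le_bound _ (by positivity) fun h => by
    simpa only [mourreK_mourreKinv_apply hM hz hεz U h] using
      norm_le_norm_mourreK hM hz hεz U (mourreKinv U M ε z h)

/-! ## §3. The dissipative resolvent `G = R(z) Kinv` -/

/-- `|Im z| ‖G h‖ ≤ ‖h‖` (the linear dissipativity bound at `f = Kinv h`).
[cite: AmreinBoutetdeMonvelGeorgescu1996, Lemma 7.3.3] -/
theorem abs_im_mul_norm_mourreG_le {M : H →L[ℂ] H} (hM : ∀ f : H, 0 ≤ (⟪f, M f⟫_ℂ).re)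
    {z : ℂ} (hz : z.im ≠ 0) {ε : ℝ} (hεz : ε * z.im ≤ 0) (U : OneParameterUnitaryGroup H) (h : H) :
    |z.im| * ‖mourreG U M ε z h‖ ≤ ‖h‖ := by
  simpa only [mourreG_apply, mourreK_mourreKinv_apply hM hz hεz U h] using
    abs_im_mul_norm_resolventAt_le hM hz hεz U (mourreKinv U M ε z h)

/-- **`‖G_ε(z)‖ ≤ 1/|Im z|`.** [cite: AmreinBoutetdeMonvelGeorgescu1996, Lemma 7.3.3] -/
theorem norm_mourreG_le {M : H →L[ℂ] H} (hM : ∀ f : H, 0 ≤ (⟪f, M f⟫_ℂ).re)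
    {z : ℂ} (hz : z.im ≠ 0) {ε : ℝ} (hεz : ε * z.im ≤ 0) (U : OneParameterUnitaryGroup H) :
    ‖mourreG U M ε z‖ ≤ |z.im|⁻¹ := by
  have hpos : 0 < |z.im| := abs_pos.2 hz
  refine ContinuousLinearMap.opNorm_le_bound _ (by positivity) fun h => ?_
  rw [← div_eq_inv_mul, le_div_iff₀' hpos]
  exact abs_im_mul_norm_mourreG_le hM hz hεz U h

/-- `‖G_ε(z) h‖ ≤ ‖h‖/|Im z|`. [cite: AmreinBoutetdeMonvelGeorgescu1996, Lemma 7.3.3] -/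
theorem norm_mourreG_apply_le {M : H →L[ℂ] H} (hM : ∀ f : H, 0 ≤ (⟪f, M f⟫_ℂ).re)
    {z : ℂ} (hz : z.im ≠ 0) {ε : ℝ} (hεz : ε * z.im ≤ 0) (U : OneParameterUnitaryGroup H) (h : H) :
    ‖mourreG U M ε z h‖ ≤ |z.im|⁻¹ * ‖h‖ :=
  (mourreG U M ε z).le_of_opNorm_le (norm_mourreG_le hM hz hεz U) h

/-! ## §4. Headline (registered helper stub) -/

/-- **Mourre's dissipative operator `1 + iε M (H - z)⁻¹` is invertible, headline form** (all
binders explicit; registered helper stub of `stub_mourreThresholdLAP`): for a one-parameter unitary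
group `U(t) = e^{itH}`, a bounded `M` with `0 ≤ Re ⟪f, M f⟫`, a real `ε` and a non-real `z` with
`ε · Im z ≤ 0`, the operator `mourreK U M ε z = 1 + iε M R(z)` has the two-sided bounded inverse
`mourreKinv U M ε z`, and Mourre's resolvent `mourreG U M ε z = R(z) (mourreK U M ε z)⁻¹` obeys
`‖G‖ ≤ 1/|Im z|`. [cite: AmreinBoutetdeMonvelGeorgescu1996, Lemma 7.3.3] -/
theorem mourreK_isUnit_dissipative :
    ∀ (K : Type) [NormedAddCommGroup K] [InnerProductSpace ℂ K] [CompleteSpace K]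
      (U : Literature.Analysis.UnboundedOperators.OneParameterUnitaryGroup K) (M : K →L[ℂ] K)
      (ε : ℝ) (z : ℂ), (∀ f : K, 0 ≤ (inner ℂ f (M f)).re) → z.im ≠ 0 → ε * z.im ≤ 0 →
        Summit.AtomisticToContinuum.FouriersLaw.Theorems.MourreDissolution.mourreK U M ε z *
              Summit.AtomisticToContinuum.FouriersLaw.Theorems.MourreDissolution.mourreKinv U M ε z = 1 ∧
          Summit.AtomisticToContinuum.FouriersLaw.Theorems.MourreDissolution.mourreKinv U M ε z *
              Summit.AtomisticToContinuum.FouriersLaw.Theorems.MourreDissolution.mourreK U M ε z = 1 ∧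
            ‖Summit.AtomisticToContinuum.FouriersLaw.Theorems.MourreDissolution.mourreG U M ε z‖ ≤
              |z.im|⁻¹ := by
  intro K _ _ _ U M ε z hM hz hεz
  exact ⟨mourreK_mul_mourreKinv hM hz hεz U, mourreKinv_mul_mourreK hM hz hεz U,
    norm_mourreG_le hM hz hεz U⟩

end Summit.AtomisticToContinuum.FouriersLaw.Theorems.MourreDissolution
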